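import Literature.AnabelianGeometry.SemiGraphs.TemperedSpecialFibreTower
import Literature.AnabelianGeometry.SemiGraphs.TemperedAnabelian
import HarnessLib

/-!
# [SemiAnbd] Example 3.10, conclusion, at the §6 curve-level interface `TemperedCurve p`:
# `Π^temp_{X_K}` and `Δ^temp_X` are temp-slim GIVEN a special-fibre tower (proof-only)

Mochizuki, *Semi-graphs of anabelioids*, Publ. RIMS **42** (2006), §3 Example 3.10, manuscript
p. 45 l. 10–12 [cite: MochizukiSemiAnbd2006, Ex 3.10 p.45]: "Since `Δ` is the inverse limit of the
`Δ[i]`, and `G_K` is slim …, we thus conclude that both `Δ` and `Π` are temp-slim", and §6 p. 69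
("`Π^temp_{X_K}` … fits into a natural exact sequence `1 → π₁^temp(X_K̄) → π₁^temp(X_K) → G_K → 1`").

The sub-DAG statements file `TemperedSpecialFibreTower.lean` (plan/L3/SUBDAG-SemiAnbd-Ex310.md)
proves the conclusion of Example 3.10 from the tower data for the GROUP-level interface
`TemperedArithmeticGroup K` (`TemperedCurves.lean`). The [EtTh]/[IUTch] consumers, however, work over
the §6 CURVE-level interface `TemperedCurve p` (`TemperedAnabelian.lean`; `ThetaSetting p extends
TemperedCurve p`), which carries NO slimness field — whence the raw hypothesis binder
`hslimX : IsSlimGroup D.PiTemp` of seven Tate-model files (plan/GAP-LEDGER.md row G-w4d021-3) and the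
parameter fields `GroupLevelData.isSlimGroup(_ker)` of the bridge `TemperedCurveBridge.lean`.
PROOF-ONLY, no definitions: for `X : TemperedCurve p`,
* `isSlimGroup_deltaTemp_of_tower` — a special-fibre tower over `Δ^temp_X = X.DeltaTemp` makes
  `Δ^temp_X` slim;
* `isSlimGroup_piTemp_of_tower` — plus the openness of the augmentation `Π^temp_{X_K} → G_{ℚ_p}`
  (the printed exact sequence is one of topological groups and `G_K` is open in `G_{ℚ_p}` for
  `K/ℚ_p` finite; the analogue of the additive `TemperedArithmeticGroup.AugIsOpenMap`) makes
  `Π^temp_{X_K}` slim, the slimness of `G_{ℚ_p}` being the tree THEOREM `galoisMLF_slim_holds`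
  ([AbsAnab] Thm. 1.1.1 (ii)).
So `hslimX` REDUCES to Example 3.10's tower data (origin statement `Ex310TowerStatement`, FACT-policy:
André's `π₁^temp` is not constructed) + the open-augmentation hypothesis; nothing is asserted, no
side is taken on anything disputed ([SemiAnbd] is a refereed 2006 paper).
-/

noncomputable section

namespace Literature.AnabelianGeometry.SemiGraphs

open Literature.AlgebraicGeometry.Frobenioids (IsSlimGroup)
open Literature.AnabelianGeometry.AbsoluteAnabelian (galoisMLF_slim_holds)

namespace TemperedCurve

variable {p : ℕ} [Fact p.Prime]

/-- **[SemiAnbd] Example 3.10, "`Δ` [is] temp-slim"**, at the §6 interface: a special-fibre tower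
over `Δ^temp_X = Ker(Π^temp_{X_K} → G_{ℚ_p})` (the data of Example 3.10 p. 44: exhaustive
characteristic sequence, special fibres of the coverings with their tempered fundamental groups,
admissible quotients, faithful outer actions) makes `Δ^temp_X` slim.
[cite: MochizukiSemiAnbd2006, Ex 3.10 p.45] -/
theorem isSlimGroup_deltaTemp_of_tower (X : TemperedCurve p) (T : SpecialFibreTower X.DeltaTemp) :
    IsSlimGroup X.DeltaTemp :=
  T.isSlimGroup_delta

/-- Under an OPEN augmentation `Π^temp_{X_K} → G_{ℚ_p}` (§6 p. 69: the exact sequence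
`1 → π₁^temp(X_K̄) → π₁^temp(X_K) → G_K → 1` is one of topological groups, and `G_K ⊆ G_{ℚ_p}` is open,
`K/ℚ_p` being finite), open subgroups of `Π^temp_{X_K}` have open images in `G_{ℚ_p}`.
[cite: MochizukiSemiAnbd2006, §6 p.69] -/
theorem isOpen_map_aug_of_isOpenMap (X : TemperedCurve p) (haug : IsOpenMap X.aug)
    (U : Subgroup X.PiTemp) (hU : IsOpen (U : Set X.PiTemp)) :
    IsOpen ((U.map X.aug.toMonoidHom : Subgroup (GQp p)) : Set (GQp p)) := by
  rw [Subgroup.coe_map]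
  exact haug _ hU

/-- **[SemiAnbd] Example 3.10, "both `Δ` and `Π` are temp-slim"**, at the §6 interface
`TemperedCurve p`: a special-fibre tower over `Δ^temp_X` and the openness of the augmentation
`Π^temp_{X_K} → G_{ℚ_p}` make `Π^temp_{X_K}` slim — "and `G_K` is slim [cf., e.g., [Mzk3], Theorem
1.1.1]" being the tree theorem `galoisMLF_slim_holds` for `G_{ℚ_p}`. This is the printed derivation
behind the raw binder `hslimX : IsSlimGroup D.PiTemp` of the Tate-model consumers (GAP-LEDGER
G-w4d021-3): `hslimX := D.toTemperedCurve.isSlimGroup_piTemp_of_tower T haug`.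
[cite: MochizukiSemiAnbd2006, Ex 3.10 p.45] -/
theorem isSlimGroup_piTemp_of_tower (X : TemperedCurve p) (T : SpecialFibreTower X.DeltaTemp)
    (haug : IsOpenMap X.aug) : IsSlimGroup X.PiTemp :=
  isSlimGroup_of_slim_ker_of_slim_quotient X.aug.toMonoidHom (X.isOpen_map_aug_of_isOpenMap haug)
    T.isSlimGroup_delta (galoisMLF_slim_holds p ℚ_[p])

/-- Both halves together, in the shape of the parameter fields `GroupLevelData.isSlimGroup` /
`GroupLevelData.isSlimGroup_ker` of the bridge `TemperedCurveBridge.lean` (there over the composite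
augmentation `augK`; here over `aug` itself, whose kernel `Δ^temp_X` is the same subgroup).
[cite: MochizukiSemiAnbd2006, Ex 3.10 p.45] -/
theorem isSlimGroup_piTemp_and_deltaTemp_of_tower (X : TemperedCurve p)
    (T : SpecialFibreTower X.DeltaTemp) (haug : IsOpenMap X.aug) :
    IsSlimGroup X.PiTemp ∧ IsSlimGroup X.DeltaTemp :=
  ⟨X.isSlimGroup_piTemp_of_tower T haug, X.isSlimGroup_deltaTemp_of_tower T⟩

end TemperedCurve

end Literature.AnabelianGeometry.SemiGraphs

end
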